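import Mathlib
import Summits.Ventures.PercRepro.TriangleCapFourRowFourCap

/-!
# PercRepro — THE ADDABLE PAIR AT THE CAP OF `(k, 4, 4)` WITH ONE TRIANGLE (p3, gen 46; part 199t, first half)

Part 199p's count leaves `E = 0`, `M ≤ 2`; `M = 2` closes below `T` by the crude bounds; `M = 1` (one triangle
`x y₁ y₂`, `P = 3K − 5`) is transferred to the cell `(k, 4, 3)` BY ADDING AN EDGE: some non-neighbour `u` of `x`
misses at least two vertices of `N(x)` (`P ≤ 3K − 6` otherwise); if it misses an unmatched vertex `y₀`, the pair
`u y₀` has no common neighbour (`u` sees only `N(x)`, `y₀` only `x` and `R`) and `P_u + d(y₀) ≥ K` (the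
non-neighbours at `K − 1` see every unmatched vertex: they miss exactly one vertex, an end of the triangle); if it
misses only the two ends, `u y₁` has no common neighbour and `P_u + d(y₁) = K − 2 + 2 + g ≥ K`
(`exists_addable_pair`). Then `D ⊔ edge u y` is a `K₄⁻`-free cap graph on `(k, 4, 3)` (part 199s) at least
`2k − 16` below its closed form (part 199k), and `Σ d²` drops by `2 (P_u + d(y)) + 2 ≥ 2K + 2`: exactly `T`
(`four_four_cap_T`). The family `T` on `(k, 4, 4)` (`tFamilyGen (k − 1) 4 2`) is a cap graph, so this is sharp.
Axioms: standard.
-/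

namespace PercRepro

namespace TriangleCap

namespace C047

open Finset

variable {V : Type*} [Fintype V] [DecidableEq V]

/-- **AN ADDABLE PAIR AT THE CAP WITH ONE TRIANGLE:** `N = N(x)` with exactly one edge `y₁ y₂` inside, `R` the three
non-neighbours (independent, every one at most `K − 1` into `N`, `Σ_R degIn N = 3K − 5`): some `u ∈ R` and `y ∈ N`
are non-adjacent, have no common neighbour, and satisfy `K ≤ degIn N u + d(y)`. -/
theorem exists_addable_pair (D : SimpleGraph V) [DecidableRel D.Adj] (hK : K4mFree D) (x : V) (N R : Finset V)
    (hmemN : ∀ w, w ∈ N ↔ D.Adj x w) (hmemR : ∀ w, w ∈ R ↔ w ≠ x ∧ ¬ D.Adj x w) (hRcard : R.card = 3)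
    (K : ℕ) (hKdef : N.card = K) (hK8 : 8 ≤ K) (hTf : ∑ y ∈ N, degIn D N y = 2)
    (hPle : ∀ u ∈ R, degIn D N u + 1 ≤ K) (hP : ∑ u ∈ R, degIn D N u + 5 = 3 * K)
    (hnoR : ∀ u ∈ R, degIn D R u = 0) :
    ∃ u ∈ R, ∃ y ∈ N, ¬ D.Adj u y ∧ (∀ w, D.Adj u w → ¬ D.Adj y w) ∧ K ≤ degIn D N u + deg D y := by
  -- every vertex of `R` has its neighbours in `N`
  have hnbN : ∀ u ∈ R, ∀ w, D.Adj u w → w ∈ N := by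
    intro u hu w huw
    have hux : ¬ D.Adj x u := ((hmemR u).mp hu).2
    have hwx : w ≠ x := fun h => hux (D.adj_symm (h ▸ huw))
    by_contra hwN
    have hwR : w ∈ R := (hmemR w).mpr ⟨hwx, fun h => hwN ((hmemN w).mpr h)⟩
    have h0 := hnoR u hu
    unfold degIn at h0
    rw [card_eq_zero, filter_eq_empty_iff] at h0
    exact h0 hwR huw
  -- the triangle edge `y₁ y₂` inside `N`
  have hle1 : ∀ w ∈ N, degIn D N w ≤ 1 := fun w hw => by
    have := degIn_nbhd_le_one D hK (x := x) (u := w) ((hmemN w).mp hw)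
    have e : univ.filter (fun v => D.Adj x v) = N := by
      ext v
      rw [mem_filter, hmemN]
      simp only [mem_univ, true_and]
    rw [e] at this
    exact this
  obtain ⟨y₁, hy₁, hy₁1⟩ : ∃ y₁ ∈ N, 1 ≤ degIn D N y₁ := by
    by_contra hcon
    push Not at hcon
    have h0 : ∑ y ∈ N, degIn D N y = 0 := sum_eq_zero (fun y hy => by have := hcon y hy; omega)
    omega
  obtain ⟨y₂, hy₂, hy₁₂⟩ : ∃ y₂ ∈ N, D.Adj y₁ y₂ := by
    unfold degIn at hy₁1
    obtain ⟨y₂, hy₂⟩ := card_pos.mp hy₁1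
    rw [mem_filter] at hy₂
    exact ⟨y₂, hy₂.1, hy₂.2⟩
  have hne12 : y₁ ≠ y₂ := D.ne_of_adj hy₁₂
  have hy₂1 : 1 ≤ degIn D N y₂ := by
    unfold degIn
    exact card_pos.mpr ⟨y₁, mem_filter.mpr ⟨hy₁, D.adj_symm hy₁₂⟩⟩
  -- every other vertex of `N` has no neighbour inside `N`
  have hy₂N' : y₂ ∈ N.erase y₁ := mem_erase.mpr ⟨hne12.symm, hy₂⟩
  have hzero : ∀ w ∈ N, w ≠ y₁ → w ≠ y₂ → degIn D N w = 0 := by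
    intro w hw hw1 hw2
    have hs := add_sum_erase N (fun y => degIn D N y) hy₁
    have hs2 := add_sum_erase (N.erase y₁) (fun y => degIn D N y) hy₂N'
    have hwmem : w ∈ (N.erase y₁).erase y₂ := mem_erase.mpr ⟨hw2, mem_erase.mpr ⟨hw1, hw⟩⟩
    have hle : degIn D N w ≤ ∑ y ∈ (N.erase y₁).erase y₂, degIn D N y :=
      single_le_sum (fun _ _ => Nat.zero_le _) hwmem
    omega
  -- a vertex `u₀ ∈ R` missing at least two vertices of `N`
  obtain ⟨u₀, hu₀, hu₀2⟩ : ∃ u₀ ∈ R, degIn D N u₀ + 2 ≤ K := by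
    by_contra hcon
    push Not at hcon
    have h : ∑ _u ∈ R, (K - 1) ≤ ∑ u ∈ R, degIn D N u :=
      sum_le_sum (fun u hu => by have := hcon u hu; omega)
    rw [sum_const, smul_eq_mul, hRcard] at h
    omega
  have hu₀x : u₀ ≠ x := ((hmemR u₀).mp hu₀).1
  -- the two other vertices of `R`
  have hcard2 : (R.erase u₀).card = 2 := by rw [card_erase_of_mem hu₀, hRcard]
  obtain ⟨u', u'', hne', hR2⟩ := card_eq_two.mp hcard2
  have hu' : u' ∈ R := mem_of_mem_erase (by rw [hR2]; exact mem_insert_self _ _)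
  have hu'' : u'' ∈ R := mem_of_mem_erase (by rw [hR2]; exact mem_insert_of_mem (mem_singleton_self _))
  have hu'0 : u' ≠ u₀ := (mem_erase.mp (by rw [hR2]; exact mem_insert_self _ _ : u' ∈ R.erase u₀)).1
  have hu''0 : u'' ≠ u₀ :=
    (mem_erase.mp (by rw [hR2]; exact mem_insert_of_mem (mem_singleton_self _) : u'' ∈ R.erase u₀)).1
  have hsumR : degIn D N u₀ + (degIn D N u' + degIn D N u'') = ∑ u ∈ R, degIn D N u := by
    rw [← add_sum_erase R _ hu₀, hR2, sum_pair hne']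
  -- a vertex of `R` at `K − 1` sees every vertex of `N` but one end of the triangle
  have hfull : ∀ u ∈ R, degIn D N u + 1 = K → ∀ w ∈ N, w ≠ y₁ → w ≠ y₂ → D.Adj u w := by
    intro u hu hdeg w hw hw1 hw2
    have hux : ¬ D.Adj x u := ((hmemR u).mp hu).2
    -- `u` misses exactly one vertex of `N`
    have hmiss : (N.filter (fun s => ¬ D.Adj u s)).card = 1 := by
      have := card_filter_add_card_filter_not (s := N) (p := fun s => D.Adj u s)
      unfold degIn at hdeg
      omega
    -- `u` misses an end of the triangle
    have hend : ¬ D.Adj u y₁ ∨ ¬ D.Adj u y₂ := by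
      by_contra hcon
      push Not at hcon
      have hxu : x ≠ u := fun h => ((hmemR u).mp hu).1 h.symm
      exact not_adj_both D hK hy₁₂ (D.adj_symm ((hmemN y₁).mp hy₁)) (D.adj_symm ((hmemN y₂).mp hy₂)) hxu
        (D.adj_symm hcon.1) (D.adj_symm hcon.2)
    by_contra huw
    obtain ⟨e, he⟩ := card_eq_one.mp hmiss
    have hwm : w ∈ N.filter (fun s => ¬ D.Adj u s) := mem_filter.mpr ⟨hw, huw⟩
    rw [he, mem_singleton] at hwm
    rcases hend with h1 | h2
    · have : y₁ ∈ N.filter (fun s => ¬ D.Adj u s) := mem_filter.mpr ⟨hy₁, h1⟩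
      rw [he, mem_singleton] at this
      exact hw1 (hwm.trans this.symm)
    · have : y₂ ∈ N.filter (fun s => ¬ D.Adj u s) := mem_filter.mpr ⟨hy₂, h2⟩
      rw [he, mem_singleton] at this
      exact hw2 (hwm.trans this.symm)
  -- the vertices of `N` missed by `u₀`
  have hmiss0 : (N.filter (fun s => ¬ D.Adj u₀ s)).card + degIn D N u₀ = K := by
    have := card_filter_add_card_filter_not (s := N) (p := fun s => D.Adj u₀ s)
    unfold degIn
    omega
  by_cases hA : ∃ y₀ ∈ N, ¬ D.Adj u₀ y₀ ∧ y₀ ≠ y₁ ∧ y₀ ≠ y₂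
  · -- CASE A: `u₀` misses an unmatched vertex `y₀`
    obtain ⟨y₀, hy₀, hn, hy₀1, hy₀2⟩ := hA
    refine ⟨u₀, hu₀, y₀, hy₀, hn, ?_, ?_⟩
    · intro w huw hyw
      have hwN := hnbN u₀ hu₀ w huw
      have h0 := hzero y₀ hy₀ hy₀1 hy₀2
      unfold degIn at h0
      rw [card_eq_zero, filter_eq_empty_iff] at h0
      exact h0 hwN hyw
    · -- `d(y₀) = 1 + g` with `g ≥` the number of vertices of `R` at `K − 1`
      have hdeg := deg_eq_of_mem_nbhd D x y₀ ((hmemN y₀).mp hy₀)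
      have eN : univ.filter (fun w => D.Adj x w) = N := by
        ext v; rw [mem_filter, hmemN]; simp only [mem_univ, true_and]
      have eR : (insert x N)ᶜ = R := by
        ext v
        rw [mem_compl, mem_insert, hmemN, hmemR]
        tauto
      rw [eN, eR, hzero y₀ hy₀ hy₀1 hy₀2] at hdeg
      have hg : ∀ u ∈ R, degIn D N u + 1 = K → u ∈ R.filter (fun u => D.Adj y₀ u) := fun u hu h =>
        mem_filter.mpr ⟨hu, D.adj_symm (hfull u hu h y₀ hy₀ hy₀1 hy₀2)⟩
      have hgle : ∀ S : Finset V, S ⊆ R.filter (fun u => D.Adj y₀ u) → S.card ≤ degIn D R y₀ :=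
        fun S hS => card_le_card hS
      by_cases h' : degIn D N u' + 1 = K
      · by_cases h'' : degIn D N u'' + 1 = K
        · have := hgle {u', u''} (by
            intro t ht
            rw [mem_insert, mem_singleton] at ht
            rcases ht with rfl | rfl
            · exact hg _ hu' h'
            · exact hg _ hu'' h'')
          rw [card_pair hne'] at this
          omega
        · have := hgle {u'} (by
            intro t ht
            rw [mem_singleton] at ht
            rw [ht]
            exact hg _ hu' h')
          rw [card_singleton] at this
          have := hPle u'' hu''
          omega
      · have := hPle u' hu'
        by_cases h'' : degIn D N u'' + 1 = K
        · have := hgle {u''} (by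
            intro t ht
            rw [mem_singleton] at ht
            rw [ht]
            exact hg _ hu'' h'')
          rw [card_singleton] at this
          omega
        · have := hPle u'' hu''
          omega
  · -- CASE B: `u₀` misses exactly the two ends `y₁ y₂`
    push Not at hA
    have hsub : N.filter (fun s => ¬ D.Adj u₀ s) ⊆ {y₁, y₂} := by
      intro s hs
      rw [mem_filter] at hs
      rw [mem_insert, mem_singleton]
      by_contra hcon
      push Not at hcon
      exact hcon.2 (hA s hs.1 hs.2 hcon.1)
    have hcardle := card_le_card hsub
    rw [card_pair hne12] at hcardle
    have heq : N.filter (fun s => ¬ D.Adj u₀ s) = {y₁, y₂} :=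
      eq_of_subset_of_card_le hsub (by rw [card_pair hne12]; omega)
    have hy₁m : y₁ ∈ N.filter (fun s => ¬ D.Adj u₀ s) := by rw [heq]; exact mem_insert_self _ _
    have hy₂m : y₂ ∈ N.filter (fun s => ¬ D.Adj u₀ s) := by
      rw [heq]; exact mem_insert_of_mem (mem_singleton_self _)
    have hn1 : ¬ D.Adj u₀ y₁ := (mem_filter.mp hy₁m).2
    have hn2 : ¬ D.Adj u₀ y₂ := (mem_filter.mp hy₂m).2
    refine ⟨u₀, hu₀, y₁, hy₁, hn1, ?_, ?_⟩
    · intro w huw hyw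
      have hwN := hnbN u₀ hu₀ w huw
      -- `w` is an `N`-neighbour of `y₁`, hence `y₂`
      have h1 : degIn D N y₁ ≤ 1 := hle1 y₁ hy₁
      unfold degIn at h1
      have hsub2 : ({w, y₂} : Finset V) ⊆ N.filter (fun s => D.Adj y₁ s) := by
        intro t ht
        rw [mem_insert, mem_singleton] at ht
        rw [mem_filter]
        rcases ht with rfl | rfl
        · exact ⟨hwN, hyw⟩
        · exact ⟨hy₂, hy₁₂⟩
      have := card_le_card hsub2
      by_cases hwy : w = y₂
      · subst hwy
        exact hn2 huw
      · rw [card_pair hwy] at this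
        omega
    · have hdeg := deg_eq_of_mem_nbhd D x y₁ ((hmemN y₁).mp hy₁)
      have eN : univ.filter (fun w => D.Adj x w) = N := by
        ext v; rw [mem_filter, hmemN]; simp only [mem_univ, true_and]
      rw [eN] at hdeg
      omega

end C047

end TriangleCap

end PercRepro
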